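import Mathlib
import Summits.KontsevichZagierPeriods.Zeta5Search.BrickTopFrobenius

/-!
# BrickPhiSymmetry — reflection `Φ_{n,p}(−n−t) = Φ_{n,p}(t)` and the size of `Φ_{n,p}` at digit points
(cell zeta5-irr)

HONEST FRAMING: systematic search; no irrationality claim unless certified. INSTRUMENT lemma of the ζ(5)
census cell zeta5-irr (HOME `run/shared/lean/pub/zeta5-irr/`; zi-p2 THEOREM 6 certificate Q-0 «Φ(−j) = Φ(−(n−j))»,
PLAN-T7 L7.3 «u(n−j) = u(j) exactly by (A5)», and the `w_j`/valuation bookkeeping of THEOREM 5 Steps C–D).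
Nothing here is about ζ(5); no irrationality content; filing moves no rung. Filed by the engine seat zi-eng (g7).

## The statements

For the Frobenius factor of the brick kernel (`BrickKernelFrobenius.brickPhi`)
`Φ_{n,p}(t) = W^{A−2B}·∏_{p∤ℓ≤np}(pt−ℓ)^B·∏_{p∤ℓ≤np}(pt+np+ℓ)^B / ∏_{p∤ℓ≤np}(pt+ℓ)^A` and ODD `p`:

* **`Φ_{n,p}(−n−t) = Φ_{n,p}(t)`** for every `t` (`brickPhi_reflect`): the two numerator products are exchanged
  (up to the sign `(−1)^{n(p−1)} = +1` each) and the denominator is reindexed by `ℓ ↦ np − ℓ`, an involution of the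
  non-multiples of `p` in `[1, np]` (`prod_filter_reflect`); in particular `Φ_{n,p}(−(n−j)) = Φ_{n,p}(−j)`
  (`brickPhi_neg_sub_natCast`).
* **`v_p(Φ_{n,p}(−j)) = 0`** for a prime `p ≥ 5`, `2B ≤ A`, every `j ∈ ℤ` (`padicValuation_brickPhi_neg_eq_one`, as
  `Rat.padicValuation p (…) = 1`): immediate from LEMMA Φ4 (`BrickPhiFour`: `v_p(Φ(−j) − 1 − λ_p q) ≥ 4`,
  `v_p(λ_p) ≥ 3`), hence by the digit-pole law (`BrickTopFrobenius.cTop_mul_prime`)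
  **`v_p(c_{jp,A}(np)) = ε + v_p(c_{j,A}(n))`** (`padicValuation_cTop_mul_prime`).
-/

namespace Summit.KontsevichZagierPeriods.Zeta5Search.BrickPhiSymmetry

open Finset Nat WithZero
open Summit.KontsevichZagierPeriods.Zeta5Search.FrobeniusFactorisation (prod_filter_not_dvd_eq_prod_prod)
open Summit.KontsevichZagierPeriods.Zeta5Search.BrickKernelFrobenius (brickPhi)
open Summit.KontsevichZagierPeriods.Zeta5Search.BrickPhiFour (phiMoment padicValuation_brickPhi_sub_le
  padicValuation_prime_mul_harmonic_le)
open Summit.KontsevichZagierPeriods.Zeta5Search.BrickTopCoefficient (cTop)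
open Summit.KontsevichZagierPeriods.Zeta5Search.BrickTopFrobenius (cTop_mul_prime)

section reflect

variable {R : Type*} [CommRing R] {p : ℕ}

/-- **`ℓ ↦ np − ℓ` is an involution of the non-multiples of `p` in `[1, np]`**: for every `f`,
`∏_{1≤ℓ≤np, p∤ℓ} f(np − ℓ) = ∏_{1≤ℓ≤np, p∤ℓ} f(ℓ)`. [folklore] -/
theorem prod_filter_reflect {M : Type*} [CommMonoid M] (p n : ℕ) (f : ℕ → M) :
    ∏ m ∈ (Icc 1 (n * p)).filter (fun m => ¬ p ∣ m), f (n * p - m) =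
      ∏ m ∈ (Icc 1 (n * p)).filter (fun m => ¬ p ∣ m), f m := by
  have hmem : ∀ a ∈ (Icc 1 (n * p)).filter (fun m => ¬ p ∣ m), n * p - a ∈ (Icc 1 (n * p)).filter (fun m => ¬ p ∣ m) := by
    intro a ha
    rw [mem_filter, mem_Icc] at ha ⊢
    have hne : a ≠ n * p := fun h => ha.2 (h ▸ dvd_mul_left p n)
    refine ⟨⟨by omega, by omega⟩, fun hd => ha.2 ?_⟩
    have h := Nat.dvd_sub (dvd_mul_left p n) hd
    rwa [Nat.sub_sub_self ha.1.2] at h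
  exact Finset.prod_nbij' (fun m => n * p - m) (fun m => n * p - m) hmem hmem
    (fun a ha => by rw [mem_filter, mem_Icc] at ha; omega) (fun a ha => by rw [mem_filter, mem_Icc] at ha; omega)
    (fun a _ => rfl)

/-- `∏_{1≤ℓ≤np, p∤ℓ}(−1) = 1` for odd `p` (each block `{bp+1,…,bp+p−1}` has `p − 1` elements, an even number). -/
theorem prod_filter_neg_one (hp : Odd p) (n : ℕ) :
    ∏ _m ∈ (Icc 1 (n * p)).filter (fun m => ¬ p ∣ m), (-1 : R) = 1 := by
  rw [prod_filter_not_dvd_eq_prod_prod hp.pos n (fun _ => (-1 : R))]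
  refine Finset.prod_eq_one fun b _ => ?_
  rw [Finset.prod_const, Nat.card_Icc, show p - 1 + 1 - 1 = p - 1 by omega]
  exact (Nat.Odd.sub_odd hp odd_one).neg_one_pow

variable {K : Type*} [Field K]

/-- **Reflection symmetry of the Frobenius factor**: for odd `p` and every `n`, `t`: `Φ_{n,p}(−n − t) = Φ_{n,p}(t)`. -/
theorem brickPhi_reflect (hp : Odd p) (A B n : ℕ) (t : K) :
    brickPhi A B p n (-(n : K) - t) = brickPhi A B p n t := by
  have hsign := prod_filter_neg_one (R := K) hp n
  -- the two numerator products are exchanged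
  have e1 : ∏ m ∈ (Icc 1 (n * p)).filter (fun m => ¬ p ∣ m), ((p : K) * (-(n : K) - t) - m) =
      ∏ m ∈ (Icc 1 (n * p)).filter (fun m => ¬ p ∣ m), ((p : K) * t + (n * p : ℕ) + m) := by
    rw [← one_mul (∏ m ∈ (Icc 1 (n * p)).filter (fun m => ¬ p ∣ m), ((p : K) * t + (n * p : ℕ) + m)), ← hsign,
      ← Finset.prod_mul_distrib]
    exact Finset.prod_congr rfl fun m _ => by push_cast; ring
  have e2 : ∏ m ∈ (Icc 1 (n * p)).filter (fun m => ¬ p ∣ m), ((p : K) * (-(n : K) - t) + (n * p : ℕ) + m) =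
      ∏ m ∈ (Icc 1 (n * p)).filter (fun m => ¬ p ∣ m), ((p : K) * t - m) := by
    rw [← one_mul (∏ m ∈ (Icc 1 (n * p)).filter (fun m => ¬ p ∣ m), ((p : K) * t - m)), ← hsign,
      ← Finset.prod_mul_distrib]
    exact Finset.prod_congr rfl fun m _ => by push_cast; ring
  -- the denominator is reindexed by `ℓ ↦ np − ℓ`
  have e3 : ∏ m ∈ (Icc 1 (n * p)).filter (fun m => ¬ p ∣ m), ((p : K) * (-(n : K) - t) + m) =
      ∏ m ∈ (Icc 1 (n * p)).filter (fun m => ¬ p ∣ m), ((p : K) * t + m) := by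
    rw [← prod_filter_reflect p n (fun m => (p : K) * t + (m : K)),
      ← one_mul (∏ m ∈ (Icc 1 (n * p)).filter (fun m => ¬ p ∣ m), ((p : K) * t + ((n * p - m : ℕ) : K))), ← hsign,
      ← Finset.prod_mul_distrib]
    refine Finset.prod_congr rfl fun m hm => ?_
    rw [mem_filter, mem_Icc] at hm
    rw [Nat.cast_sub hm.1.2]
    push_cast
    ring
  unfold brickPhi
  rw [e1, e2, e3]
  ring

/-- In particular **`Φ_{n,p}(−(n−j)) = Φ_{n,p}(−j)`** for `j ≤ n` (zi-p2's `u(n−j) = u(j)`). -/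
theorem brickPhi_neg_sub_natCast (hp : Odd p) (A B : ℕ) {n j : ℕ} (hj : j ≤ n) :
    brickPhi A B p n (-((n - j : ℕ) : K)) = brickPhi A B p n (-(j : K)) := by
  rw [← brickPhi_reflect hp A B n (-(j : K)), Nat.cast_sub hj]
  ring_nf

end reflect

section size

variable {p : ℕ} [Fact p.Prime]

/-- **`Φ_{n,p}(−j)` is a `p`-adic unit**: for a prime `p ≥ 5`, `2B ≤ A`, every `n` and every `j ∈ ℤ`,
`v_p(Φ_{n,p}(−j)) = 0` (from LEMMA Φ4: `Φ(−j) = 1 + λ_p q + O(p⁴)`, `v_p(λ_p) ≥ 3`). -/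
theorem padicValuation_brickPhi_neg_eq_one (h3 : 3 < p) {A B : ℕ} (hAB : 2 * B ≤ A) (n : ℕ) (j : ℤ) :
    Rat.padicValuation p (brickPhi A B p n (-(j : ℚ))) = 1 := by
  have h4 := padicValuation_brickPhi_sub_le (p := p) h3 hAB n j
  have hl := padicValuation_prime_mul_harmonic_le (p := p) h3
  have hq : Rat.padicValuation p ((phiMoment A B n j : ℚ)) ≤ 1 := by
    rw [Rat.padicValuation_cast]; exact Int.padicValuation_le_one p _
  -- `Φ(−j) − 1` has valuation `< 1`
  have hsmall : Rat.padicValuation p (brickPhi A B p n (-(j : ℚ)) - 1) < 1 := by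
    have e : brickPhi A B p n (-(j : ℚ)) - 1 =
        (brickPhi A B p n (-(j : ℚ)) - 1 - (p : ℚ) * harmonic (p - 1) * (phiMoment A B n j : ℚ)) +
          (p : ℚ) * harmonic (p - 1) * (phiMoment A B n j : ℚ) := by ring
    rw [e]
    refine (Valuation.map_add_le _ (le_trans h4 ?_) ?_).trans_lt ?_ (b := exp (-3))
    · rw [exp_le_exp]; norm_num
    · rw [map_mul]
      calc Rat.padicValuation p ((p : ℚ) * harmonic (p - 1)) * Rat.padicValuation p (phiMoment A B n j : ℚ)
          ≤ exp (-3) * 1 := by gcongr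
        _ = exp (-3) := mul_one _
    · rw [← exp_zero, exp_lt_exp]; norm_num
  have := Valuation.map_one_add_of_lt (Rat.padicValuation p) hsmall
  rwa [add_sub_cancel] at this

/-- **Digit poles keep the valuation of the leading coefficient up to `p^ε`**: for a prime `p ≥ 5`, `2B ≤ A`,
`j ≤ n`: `v_p(c_{jp,A}(np)) = ε + v_p(c_{j,A}(n))`, as `Rat.padicValuation p (cTop (np) (jp)) = exp(−ε)·(…)`. -/
theorem padicValuation_cTop_mul_prime (h3 : 3 < p) {A B : ℕ} (hAB : 2 * B ≤ A) (ε : ℕ) {n j : ℕ} (hj : j ≤ n) :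
    Rat.padicValuation p (cTop A B ε (n * p) (j * p)) = exp (-(ε : ℤ)) * Rat.padicValuation p (cTop A B ε n j) := by
  have hp : p.Prime := Fact.out
  rw [cTop_mul_prime hAB ε hp.pos hj, map_mul, map_mul, map_pow, Rat.padicValuation_self,
    show (-(j : ℚ)) = -((j : ℤ) : ℚ) by push_cast; ring, padicValuation_brickPhi_neg_eq_one h3 hAB n (j : ℤ),
    mul_one, ← exp_nsmul]
  simp

end size

end Summit.KontsevichZagierPeriods.Zeta5Search.BrickPhiSymmetry
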